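import Summits.Ventures.DiscreteObjects.PP12.PrimeOrderAtlasV2
import Summits.Ventures.DiscreteObjects.PP12.NoPlanarOrderThree

/-!
# PP(12): the prime-order atlas, version 3 — the planar order-3 branch removed (kernel)
Framing: lottery ticket; floor = certified bounds/negative ranges.

`prime_order_atlas_order12_v2` (`PrimeOrderAtlasV2.lean`) lists the fixed structure of every prime-order collineation `σ ≠ 1`,
`σ ^ p = 1`, of a projective plane of order 12: `p ∈ {2, 3, 5, 11, 13}` with an explicit numerical type for each. With
`no_planar_order_three` (`NoPlanarOrderThree.lean`, designs g10: no collineation of order 3 has a planar fixed structure of order 3)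
the `p = 3` branch loses its planar alternative: **`prime_order_atlas_order12_v3`**. The entries of the list NOT excluded in print are
now exactly: `p = 2` (one involutory elation) and `p = 3` of FLAG type (`1, 4, 7` or `10` fixed points) — the live cells of the
census (cell pub-namedobj, target M). Everything proved, nothing assumed; no `sorry`, no new axioms.
-/

namespace Summit.Ventures.DiscreteObjects.PP12

open Configuration Finset
open scoped Classical

namespace Collineation

variable {P L : Type*} [Membership P L] [ProjectivePlane P L] [Fintype P] [Fintype L]
  [DecidableEq P] [DecidableEq L] (σ : Collineation P L)

/-- **Prime-order atlas for a projective plane of order 12, version 3.** For a collineation `σ ≠ 1` with `σ ^ p = 1` on points,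
`p` prime: `σ` fixes as many lines as points, and `p = 2` (elation, 13 fixed points), or `p = 3` (elation; or flag type with
1, 4, 7 or 10 fixed points — the planar type is impossible), or `p = 5` (a fixed Fano subplane), or `p = 11` (homology with 14 fixed
points, or triangle), or `p = 13` (a unique fixed antiflag). -/
theorem prime_order_atlas_order12_v3 (h12 : ProjectivePlane.order P L = 12) (hne : σ.onPoints ≠ 1) {p : ℕ}
    (hp : p.Prime) (hq : σ.onPoints ^ p = 1) :
    fixedCard σ.onLines = fixedCard σ.onPoints ∧
    ((p = 2 ∧ ∃ (l : L) (c : P), σ.IsAxis l ∧ σ.IsCenter c ∧ c ∈ l ∧ fixedCard σ.onPoints = 13) ∨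
     (p = 3 ∧ ((∃ (l : L) (c : P), σ.IsAxis l ∧ σ.IsCenter c ∧ c ∈ l ∧ fixedCard σ.onPoints = 13) ∨
       (∃ (l : L) (c : P), σ.onLines l = l ∧ σ.onPoints c = c ∧ c ∈ l ∧ (∀ x : P, σ.onPoints x = x → x ∈ l) ∧
         (∀ m : L, σ.onLines m = m → c ∈ m) ∧
         (fixedCard σ.onPoints = 1 ∨ fixedCard σ.onPoints = 4 ∨ fixedCard σ.onPoints = 7 ∨
           fixedCard σ.onPoints = 10)))) ∨
     (p = 5 ∧ fixedCard σ.onPoints = 7 ∧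
       (∀ l : L, σ.onLines l = l → σ.fixedOnLine l = 3) ∧ (∀ x : P, σ.onPoints x = x → σ.fixedThrough x = 3)) ∨
     (p = 11 ∧ ((∃ (l : L) (c : P), σ.IsAxis l ∧ σ.IsCenter c ∧ c ∉ l ∧ fixedCard σ.onPoints = 14) ∨
       (fixedCard σ.onPoints = 3 ∧ ∀ l : L, σ.onLines l = l → ∀ [DecidablePred (· ∈ l)], σ.fixedOnLine l = 2))) ∨
     (p = 13 ∧ (∃! x : P, σ.onPoints x = x) ∧ (∃! l : L, σ.onLines l = l) ∧
       ∀ (x : P) (l : L), σ.onPoints x = x → σ.onLines l = l → x ∉ l)) := by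
  obtain ⟨hfix, h⟩ := σ.prime_order_atlas_order12_v2 h12 hne hp hq
  refine ⟨hfix, ?_⟩
  rcases h with h | ⟨h3, hcases⟩ | h | h | h
  · exact Or.inl h
  · rcases hcases with hel | ⟨hf13, hk4, ht4⟩ | hflag
    · exact Or.inr (Or.inl ⟨h3, Or.inl hel⟩)
    · subst h3
      have hg13 : fixedCard σ.onLines = 13 := by rw [hfix, hf13]
      exact (σ.no_planar_order_three h12 hq hf13 hg13 hk4 ht4).elim
    · exact Or.inr (Or.inl ⟨h3, Or.inr hflag⟩)
  · exact Or.inr (Or.inr (Or.inl h))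
  · exact Or.inr (Or.inr (Or.inr (Or.inl h)))
  · exact Or.inr (Or.inr (Or.inr (Or.inr h)))

end Collineation

end Summit.Ventures.DiscreteObjects.PP12
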